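import Summits.QuantumFields.YangMills.Theorems.LuscherReductionTwistedTraceScalingBTKineticSquares
import Summits.QuantumFields.YangMills.Theorems.LuscherReductionTwistedTraceScalingFPWeightChart
import Summits.QuantumFields.YangMills.Theorems.LuscherReductionTwistedTraceScalingBTTails
import Mathlib.Analysis.Quaternion
import HarnessLib

/-!
# (B-ST) atom (B4a), part 1: THE KINETIC DEFECT OF THE CENTRAL TUBE AGAINST A BASED GAUGE COPY IS THE FLAT QUADRATIC FORM `‖x̂ − x̂' + ∇η‖²` UP TO A CUBIC ERROR
# (lane A of S-BASE, crux `TwistedTraceScaling` stmt-QuantumFields-20203, C4-CORE, the (B-ST) pen; `pub/ym-fleet/ym-luscher-20007-p1/HANDOFF-g22.md` §DESIGN 1–2)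

The based central kernel of the fibre block is `cM(x,x') = ∫ K_β(orthoTube 1 x, (orthoTube 1 x')^{basedExt h}) dh`, and by ✓`…BTKineticSquares.transferKernel_gaugeTransform_eq`
`K_β(U, V^g) = exp(β(2|E| − kinDefect U V g) − (β/2)(S U + S V))` EXACTLY, `kinDefect U V g = Σ_e ‖q(U_e)q(g_y) − q(g_x)q(V_e)‖²_ℍ`.  So the only configuration-dependent
input of a LOWER bound for `cM` is an UPPER bound for the kinetic defect.  THIS FILE: the defect is the flat quadratic form of the linearised problem up to a cubic error —
* §1 quaternion bookkeeping: `one_sub_scalarPart_eq` (`1 − u₀ = ‖q(U) − 1‖²/2`), `quat_norm_le_abs_re_add_sqrt`, `quat_sqrt_im_le_norm`;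
* §2 ★ `edge_defect_sq_le` — ONE LINK: if `‖q(A)−1‖, ‖q(A')−1‖, ‖q(G_x)−1‖, ‖q(G_y)−1‖ ≤ τ ≤ 1` then
  `‖q(A)q(G_y) − q(G_x)q(A')‖² ≤ Σ_a (A⃗_a − A'⃗_a + G⃗_{y,a} − G⃗_{x,a})² + 33τ³` (exact identity `D = ℓ + (q_A−1)(q_{G_y}−1) − (q_{G_x}−1)(q_{A'}−1)`, `ℓ = (q_A − q_{A'}) + (q_{G_y} − q_{G_x})`,
  `|Re ℓ| ≤ τ²` because `1 − Re q = ‖q−1‖²/2`);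
* §3 ★★ `kinDefect_le_norm_sq_add` — ALL LINKS: `kinDefect U V g ≤ ‖Ξ‖² + 33|E|τ³` with `Ξ_{(e,a)} = U⃗_{e,a} − V⃗_{e,a} + (∇ g⃗)_{(e,a)}` (`∇ = vacGrad`, `g⃗ = vecPart ∘ g`);
* §4 the central tube against a based chart copy: `vecPart (orthoTube 1 x e) = x_e`, `vecPart ∘ basedExt(gno∘w) = gnoParam w`, the size bounds `‖q(orthoTube 1 x e) − 1‖ ≤ √2‖x̂‖`,
  `‖q(basedExt(gno∘w) z) − 1‖ ≤ √3‖w‖`, `norm_vacGrad_le` (`‖∇φ‖ ≤ 2√(3|E|)‖φ‖∞`), and ★★★ `kinDefect_central_based_le`: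
  `kinDefect (orthoTube 1 x) (orthoTube 1 x') (basedExt (gno ∘ w)) ≤ ‖linkEmbed (x − x') + ∇(flatLin w)‖² + 201|E|τ³`
  whenever `√2‖x̂‖, √2‖x̂'‖, √3‖w‖ ≤ τ ≤ 1` (gnomonic vs orthographic is cubic: ✓`norm_gnoParam_sub_flatLin_le`).
With `τ = O(β^{-1/2}ℓ)` on the profile support the error `β·201|E|τ³ = O(β^{-1/2}ℓ³) → 0`: the based Gaussian integral of `e^{−β·kinDefect}` is a FLAT Gaussian in `w` (next file).
HONEST FRAMING: quaternion algebra for a stub of a child of the CONDITIONAL route R2b1; (B-ST) OPEN; C4-CORE OPEN; not infinite volume, not a gap, not Clay.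
-/

set_option autoImplicit false

noncomputable section

open MeasureTheory Filter Topology Real
open scoped BigOperators Matrix Quaternion
open Literature.MathematicalPhysics.QuantumFieldTheory
open Literature.MathematicalPhysics.QuantumLattice

namespace Summit.QuantumFields.YangMills.Theorems.FemtoTransferGap.TwoLattice.ConstTube

open Summit.QuantumFields.YangMills.Theorems.FemtoTransferGap
open Summit.QuantumFields.YangMills.Theorems.FemtoTransferGap.TwoLattice
open Summit.QuantumFields.YangMills.Theorems.FemtoTransferGap.TwoLattice.Avg
open Summit.QuantumFields.YangMills.Theorems.FemtoTransferGap.TwoLattice.Stiff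
open Summit.QuantumFields.YangMills.Theorems.FemtoTransferGap.TwoLattice.GnChart
open Summit.QuantumFields.YangMills.Theorems.FemtoTransferGap.TwoLattice.Cov (scalarPart_inv vecPart_inv)
open Literature.MathematicalPhysics.QuantumFieldTheory.Balaban1983to89.T4CubeChartGnomonic (gnoPoint)

variable {L : ℕ} [NeZero L]

/-! ## §1 Quaternion bookkeeping -/

/-- `1 − u₀ = ‖q(U) − 1‖²/2`. [cite: MontvayMunster1994, §3.2.3 (3.97)] -/
theorem one_sub_scalarPart_eq (U : SU2) : 1 - scalarPart U = ‖su2Quat U - 1‖ ^ 2 / 2 := by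
  have h := scalarPart_mul_inv_eq_one_sub U 1
  rw [inv_one, mul_one, su2Quat_one] at h
  linarith

/-- `‖q‖ ≤ |Re q| + √(Σ (Im q)²)`. [folklore] -/
theorem quat_norm_le_abs_re_add_sqrt (q : ℍ) : ‖q‖ ≤ |q.re| + Real.sqrt (q.imI ^ 2 + q.imJ ^ 2 + q.imK ^ 2) := by
  set S := q.imI ^ 2 + q.imJ ^ 2 + q.imK ^ 2 with hS
  have hS0 : 0 ≤ S := by positivity
  have hn : ‖q‖ ^ 2 = q.re ^ 2 + S := by
    rw [sq, ← Quaternion.normSq_eq_norm_mul_self, Quaternion.normSq_def']; simp only [hS, sq]; ring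
  have h : ‖q‖ ^ 2 ≤ (|q.re| + Real.sqrt S) ^ 2 := by
    rw [hn]; nlinarith [sq_abs q.re, Real.sq_sqrt hS0, Real.sqrt_nonneg S, abs_nonneg q.re]
  exact (pow_le_pow_iff_left₀ (norm_nonneg q) (by positivity) two_ne_zero).1 h

/-- `√(Σ (Im q)²) ≤ ‖q‖`. [folklore] -/
theorem quat_sqrt_im_le_norm (q : ℍ) : Real.sqrt (q.imI ^ 2 + q.imJ ^ 2 + q.imK ^ 2) ≤ ‖q‖ := by
  have hn : ‖q‖ ^ 2 = q.re ^ 2 + (q.imI ^ 2 + q.imJ ^ 2 + q.imK ^ 2) := by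
    rw [sq, ← Quaternion.normSq_eq_norm_mul_self, Quaternion.normSq_def']; ring
  calc Real.sqrt (q.imI ^ 2 + q.imJ ^ 2 + q.imK ^ 2) ≤ Real.sqrt (‖q‖ ^ 2) := Real.sqrt_le_sqrt (by rw [hn]; nlinarith [sq_nonneg q.re])
    _ = ‖q‖ := Real.sqrt_sq (norm_nonneg q)

/-- Components of `vecPart` as quaternion imaginary parts. [folklore] -/
theorem vecPart_components (U : SU2) : vecPart U 0 = (su2Quat U).imI ∧ vecPart U 1 = (su2Quat U).imJ ∧ vecPart U 2 = (su2Quat U).imK := by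
  simp [vecPart]

/-! ## §2 One link -/

/-- ★ **One link**: for `‖q(A)−1‖, ‖q(A')−1‖, ‖q(G_x)−1‖, ‖q(G_y)−1‖ ≤ τ ≤ 1`,
`‖q(A)q(G_y) − q(G_x)q(A')‖² ≤ Σ_a (A⃗_a − A'⃗_a + G⃗_{y,a} − G⃗_{x,a})² + 33τ³`. [folklore] -/
theorem edge_defect_sq_le (A A' Gx Gy : SU2) {τ : ℝ} (hτ1 : τ ≤ 1) (hA : ‖su2Quat A - 1‖ ≤ τ) (hA' : ‖su2Quat A' - 1‖ ≤ τ)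
    (hGx : ‖su2Quat Gx - 1‖ ≤ τ) (hGy : ‖su2Quat Gy - 1‖ ≤ τ) :
    ‖su2Quat A * su2Quat Gy - su2Quat Gx * su2Quat A'‖ ^ 2 ≤
      (∑ a, (vecPart A a - vecPart A' a + vecPart Gy a - vecPart Gx a) ^ 2) + 33 * τ ^ 3 := by
  have hτ0 : 0 ≤ τ := (norm_nonneg _).trans hA
  set a := su2Quat A with ha
  set a' := su2Quat A' with ha'
  set gx := su2Quat Gx with hgx
  set gy := su2Quat Gy with hgy
  set ℓ : ℍ := (a - a') + (gy - gx) with hℓ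
  have e : a * gy - gx * a' = ℓ + ((a - 1) * (gy - 1) - (gx - 1) * (a' - 1)) := by rw [hℓ]; noncomm_ring
  -- the remainder
  have hR : ‖(a - 1) * (gy - 1) - (gx - 1) * (a' - 1)‖ ≤ 2 * τ ^ 2 := by
    refine (norm_sub_le _ _).trans ?_
    rw [norm_mul, norm_mul]
    nlinarith [mul_le_mul hA hGy (norm_nonneg _) hτ0, mul_le_mul hGx hA' (norm_nonneg _) hτ0]
  -- the real part of the linear term
  have hre : |ℓ.re| ≤ τ ^ 2 := by
    have h1 := one_sub_scalarPart_eq A; have h2 := one_sub_scalarPart_eq A'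
    have h3 := one_sub_scalarPart_eq Gx; have h4 := one_sub_scalarPart_eq Gy
    simp only [scalarPart] at h1 h2 h3 h4
    rw [← ha] at h1; rw [← ha'] at h2; rw [← hgx] at h3; rw [← hgy] at h4
    have hℓre : ℓ.re = (a.re - a'.re) + (gy.re - gx.re) := by simp [hℓ]
    have b1 : ‖a - 1‖ ^ 2 ≤ τ ^ 2 := pow_le_pow_left₀ (norm_nonneg _) hA 2
    have b2 : ‖a' - 1‖ ^ 2 ≤ τ ^ 2 := pow_le_pow_left₀ (norm_nonneg _) hA' 2
    have b3 : ‖gx - 1‖ ^ 2 ≤ τ ^ 2 := pow_le_pow_left₀ (norm_nonneg _) hGx 2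
    have b4 : ‖gy - 1‖ ^ 2 ≤ τ ^ 2 := pow_le_pow_left₀ (norm_nonneg _) hGy 2
    rw [hℓre, abs_le]
    constructor <;> nlinarith [sq_nonneg ‖a - 1‖, sq_nonneg ‖a' - 1‖, sq_nonneg ‖gx - 1‖, sq_nonneg ‖gy - 1‖]
  -- the imaginary part of the linear term
  set m := Real.sqrt (∑ c, (vecPart A c - vecPart A' c + vecPart Gy c - vecPart Gx c) ^ 2) with hm
  have hsum0 : 0 ≤ ∑ c, (vecPart A c - vecPart A' c + vecPart Gy c - vecPart Gx c) ^ 2 := Finset.sum_nonneg fun c _ => sq_nonneg _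
  have him : ℓ.imI ^ 2 + ℓ.imJ ^ 2 + ℓ.imK ^ 2 = ∑ c, (vecPart A c - vecPart A' c + vecPart Gy c - vecPart Gx c) ^ 2 := by
    simp only [Fin.sum_univ_three, vecPart, hℓ, ha, ha', hgx, hgy, Matrix.cons_val_zero, Matrix.cons_val_one, Matrix.cons_val_two,
      Matrix.head_cons, Matrix.tail_cons, Quaternion.imI_add, Quaternion.imI_sub, Quaternion.imJ_add, Quaternion.imJ_sub,
      Quaternion.imK_add, Quaternion.imK_sub]
    ring
  have hℓn : ‖ℓ‖ ≤ |ℓ.re| + m := by rw [hm, ← him]; exact quat_norm_le_abs_re_add_sqrt ℓ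
  have hmℓ : m ≤ ‖ℓ‖ := by rw [hm, ← him]; exact quat_sqrt_im_le_norm ℓ
  have hℓ4 : ‖ℓ‖ ≤ 4 * τ := by
    have e2 : ℓ = (a - 1) - (a' - 1) + ((gy - 1) - (gx - 1)) := by rw [hℓ]; abel
    rw [e2]
    calc ‖(a - 1) - (a' - 1) + ((gy - 1) - (gx - 1))‖ ≤ ‖(a - 1) - (a' - 1)‖ + ‖(gy - 1) - (gx - 1)‖ := norm_add_le _ _
      _ ≤ (‖a - 1‖ + ‖a' - 1‖) + (‖gy - 1‖ + ‖gx - 1‖) := add_le_add (norm_sub_le _ _) (norm_sub_le _ _)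
      _ ≤ 4 * τ := by linarith
  have hm0 : 0 ≤ m := Real.sqrt_nonneg _
  have hm4 : m ≤ 4 * τ := hmℓ.trans hℓ4
  -- assemble
  have hD : ‖a * gy - gx * a'‖ ≤ m + 3 * τ ^ 2 := by
    rw [e]
    calc ‖ℓ + ((a - 1) * (gy - 1) - (gx - 1) * (a' - 1))‖ ≤ ‖ℓ‖ + ‖(a - 1) * (gy - 1) - (gx - 1) * (a' - 1)‖ := norm_add_le _ _
      _ ≤ (|ℓ.re| + m) + 2 * τ ^ 2 := add_le_add hℓn hR
      _ ≤ m + 3 * τ ^ 2 := by linarith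
  have hD0 : 0 ≤ ‖a * gy - gx * a'‖ := norm_nonneg _
  have hsq : ‖a * gy - gx * a'‖ ^ 2 ≤ (m + 3 * τ ^ 2) ^ 2 := pow_le_pow_left₀ hD0 hD 2
  have hm2 : m ^ 2 = ∑ c, (vecPart A c - vecPart A' c + vecPart Gy c - vecPart Gx c) ^ 2 := by rw [hm, Real.sq_sqrt hsum0]
  have hτ3 : τ ^ 4 ≤ τ ^ 3 := by nlinarith [pow_nonneg hτ0 3]
  calc ‖a * gy - gx * a'‖ ^ 2 ≤ (m + 3 * τ ^ 2) ^ 2 := hsq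
    _ = m ^ 2 + 6 * τ ^ 2 * m + 9 * τ ^ 4 := by ring
    _ ≤ m ^ 2 + 6 * τ ^ 2 * (4 * τ) + 9 * τ ^ 3 := by nlinarith [mul_le_mul_of_nonneg_left hm4 (by positivity : (0 : ℝ) ≤ 6 * τ ^ 2)]
    _ = (∑ c, (vecPart A c - vecPart A' c + vecPart Gy c - vecPart Gx c) ^ 2) + 33 * τ ^ 3 := by rw [hm2]; ring

/-! ## §3 All links -/

/-- ★★ **All links**: `kinDefect U V g ≤ ‖Ξ‖² + 33|E|τ³` with `Ξ = linkEmbed(U⃗ − V⃗) + ∇(g⃗)`, if every `‖q(U_e)−1‖, ‖q(V_e)−1‖, ‖q(g_z)−1‖ ≤ τ ≤ 1`. [cite: Luscher1983, §3] -/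
theorem kinDefect_le_norm_sq_add (U V : GaugeConfig 3 L SU2) (g : Site 3 L → SU2) {τ : ℝ} (hτ1 : τ ≤ 1)
    (hU : ∀ e, ‖su2Quat (U e) - 1‖ ≤ τ) (hV : ∀ e, ‖su2Quat (V e) - 1‖ ≤ τ) (hg : ∀ z, ‖su2Quat (g z) - 1‖ ≤ τ) :
    kinDefect L U V g ≤
      ‖linkEmbed L (fun e a => vecPart (U e) a - vecPart (V e) a) + vacGrad L (fun z => vecPart (g z))‖ ^ 2 + 33 * Fintype.card (Edge 3 L) * τ ^ 3 := by
  have hnorm : ‖linkEmbed L (fun e a => vecPart (U e) a - vecPart (V e) a) + vacGrad L (fun z => vecPart (g z))‖ ^ 2 =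
      ∑ e : Edge 3 L, ∑ a : Fin 3, (vecPart (U e) a - vecPart (V e) a + vecPart (g (e.1.shift e.2)) a - vecPart (g e.1) a) ^ 2 := by
    rw [EuclideanSpace.norm_sq_eq, Fintype.sum_prod_type]
    refine Finset.sum_congr rfl fun e _ => Finset.sum_congr rfl fun a _ => ?_
    rw [Real.norm_eq_abs, sq_abs, PiLp.add_apply, linkEmbed_apply, vacGrad_apply]; ring
  rw [hnorm]
  unfold kinDefect
  calc ∑ e : Edge 3 L, ‖su2Quat (U e) * su2Quat (g (e.1.shift e.2)) - su2Quat (g e.1) * su2Quat (V e)‖ ^ 2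
      ≤ ∑ e : Edge 3 L, ((∑ a : Fin 3, (vecPart (U e) a - vecPart (V e) a + vecPart (g (e.1.shift e.2)) a - vecPart (g e.1) a) ^ 2) + 33 * τ ^ 3) :=
        Finset.sum_le_sum fun e _ => edge_defect_sq_le (U e) (V e) (g e.1) (g (e.1.shift e.2)) hτ1 (hU e) (hV e) (hg _) (hg _)
    _ = _ := by rw [Finset.sum_add_distrib, Finset.sum_const, Finset.card_univ, nsmul_eq_mul]; ring

/-! ## §4 The central tube against a based gnomonic-chart copy -/

omit [NeZero L] in
/-- The central tube link is the chart link: `orthoTube L 1 x e = chartSU2 (x e)`. [folklore] -/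
theorem orthoTube_one_apply (x : Edge 3 L → Fin 3 → ℝ) (e : Edge 3 L) : orthoTube L 1 x e = chartSU2 (x e) := by
  rw [orthoTube_apply, Pi.one_apply, mul_one]

omit [NeZero L] in
/-- On the cap, `vecPart (orthoTube L 1 x e) = x e`. [folklore] -/
theorem vecPart_orthoTube_one {x : Edge 3 L → Fin 3 → ℝ} (hx : ∀ e, ∑ a, x e a ^ 2 ≤ 1) (e : Edge 3 L) : vecPart (orthoTube L 1 x e) = x e := by
  rw [orthoTube_one_apply]; exact vecPart_chartSU2 (hx e)

/-- ★ `‖q(orthoTube L 1 x e) − 1‖ ≤ √2·‖linkEmbed x‖` on the cap. [folklore] -/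
theorem norm_su2Quat_orthoTube_one_sub_one_le {x : Edge 3 L → Fin 3 → ℝ} (hx : ∀ e, ∑ a, x e a ^ 2 ≤ 1) (e : Edge 3 L) :
    ‖su2Quat (orthoTube L 1 x e) - 1‖ ≤ Real.sqrt 2 * ‖linkEmbed L x‖ := by
  have h := norm_su2Quat_orthoTube_sub_one_le (L := L) 1 hx e
  simp only [Pi.one_apply, su2Quat_one, sub_self, norm_zero, add_zero] at h
  exact h

omit [NeZero L] in
/-- `‖q(gnoPoint v) − 1‖² ≤ Σ_a v_a²` (`1 − 1/√(1+u) ≤ u/2`). [folklore] -/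
theorem norm_su2Quat_gnoPoint_sub_one_sq_le (v : Fin 3 → ℝ) : ‖su2Quat (gnoPoint v) - 1‖ ^ 2 ≤ ∑ a, v a ^ 2 := by
  have h := one_sub_scalarPart_eq (gnoPoint v)
  obtain ⟨hs, hsA, -⟩ := gnoPoint_chart v
  set s := scalarPart (gnoPoint v)
  set u := ∑ a, v a ^ 2
  have hu : 0 ≤ u := Finset.sum_nonneg fun a _ => sq_nonneg _
  -- `2(1 − s) ≤ u` from `s²(1+u) = 1`, `0 < s`: `(1 − s)(2 − (1+s)·?)`…: `1 − s² = s²u`, `1 − s = s²u/(1+s) ≤ u/2` since `2s² ≤ 1 + s`.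
  have hs1 : s ≤ 1 := by nlinarith
  have key : 2 * (1 - s) ≤ u := by nlinarith [mul_nonneg (mul_nonneg hs.le hs.le) hu, sq_nonneg (1 - s)]
  linarith

/-- ★ `‖q(basedExt (gno ∘ w) z) − 1‖ ≤ √3·‖w‖` for every site `z`. [folklore] -/
theorem norm_su2Quat_basedExt_gno_sub_one_le (w : NzSite L → Fin 3 → ℝ) (z : Site 3 L) :
    ‖su2Quat (basedExt L (fun y => gnoPoint (w y)) z) - 1‖ ≤ Real.sqrt 3 * ‖w‖ := by
  have h0 : 0 ≤ Real.sqrt 3 * ‖w‖ := by positivity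
  by_cases hz : z = 0
  · subst hz; rw [basedExt_zero, su2Quat_one, sub_self, norm_zero]; exact h0
  · rw [basedExt_of_ne L _ hz]
    have h1 := norm_su2Quat_gnoPoint_sub_one_sq_le (w ⟨z, hz⟩)
    have h2 : ∑ a, w ⟨z, hz⟩ a ^ 2 ≤ 3 * ‖w‖ ^ 2 := by
      have hc : ∀ a, w ⟨z, hz⟩ a ^ 2 ≤ ‖w‖ ^ 2 := fun a => by
        have := (abs_le_norm_of_pi w ⟨z, hz⟩ a)
        rw [← sq_abs]; exact pow_le_pow_left₀ (abs_nonneg _) this 2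
      calc ∑ a, w ⟨z, hz⟩ a ^ 2 ≤ ∑ _a : Fin 3, ‖w‖ ^ 2 := Finset.sum_le_sum fun a _ => hc a
        _ = 3 * ‖w‖ ^ 2 := by simp
    have h3 : ‖su2Quat (gnoPoint (w ⟨z, hz⟩)) - 1‖ ^ 2 ≤ (Real.sqrt 3 * ‖w‖) ^ 2 := by
      rw [mul_pow, Real.sq_sqrt (by norm_num)]; exact h1.trans h2
    exact (pow_le_pow_iff_left₀ (norm_nonneg _) h0 two_ne_zero).1 h3
where
  /-- `|w z a| ≤ ‖w‖` for the sup norm. [folklore] -/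
  abs_le_norm_of_pi (w : NzSite L → Fin 3 → ℝ) (y : NzSite L) (a : Fin 3) : |w y a| ≤ ‖w‖ :=
    (Real.norm_eq_abs _ ▸ norm_le_pi_norm (w y) a).trans (norm_le_pi_norm w y)

omit [NeZero L] in
/-- `vecPart (basedExt (gno ∘ w) z) = (gnoParam w) z`. [folklore] -/
theorem vecPart_basedExt_gno (w : NzSite L → Fin 3 → ℝ) (z : Site 3 L) :
    vecPart (basedExt L (fun y => gnoPoint (w y)) z) = (gnoParam L w : Site 3 L → Fin 3 → ℝ) z := by
  by_cases hz : z = 0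
  · subst hz
    rw [basedExt_zero]
    have h0 : (gnoParam L w : Site 3 L → Fin 3 → ℝ) 0 = 0 := (gnoParam L w).2
    rw [h0]; funext a; fin_cases a <;> simp [vecPart, su2Quat_one]
  · rw [basedExt_of_ne L _ hz]; unfold gnoParam; rw [flatLin_apply_of_ne L _ hz]

/-- ★ `‖∇φ‖ ≤ 2√(3|E|)·‖φ‖∞`. [folklore] -/
theorem norm_vacGrad_le (φ : Site 3 L → Fin 3 → ℝ) : ‖vacGrad L φ‖ ≤ 2 * Real.sqrt (3 * Fintype.card (Edge 3 L)) * ‖φ‖ := by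
  have hφ0 : 0 ≤ ‖φ‖ := norm_nonneg _
  have hc : ∀ (e : Edge 3 L) (a : Fin 3), (vacGrad L φ (e, a)) ^ 2 ≤ (2 * ‖φ‖) ^ 2 := fun e a => by
    rw [vacGrad_apply, ← sq_abs]
    refine pow_le_pow_left₀ (abs_nonneg _) ?_ 2
    have h1 : |φ (e.1.shift e.2) a| ≤ ‖φ‖ := (Real.norm_eq_abs _ ▸ norm_le_pi_norm (φ _) a).trans (norm_le_pi_norm φ _)
    have h2 : |φ e.1 a| ≤ ‖φ‖ := (Real.norm_eq_abs _ ▸ norm_le_pi_norm (φ _) a).trans (norm_le_pi_norm φ _)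
    calc |φ (e.1.shift e.2) a - φ e.1 a| ≤ |φ (e.1.shift e.2) a| + |φ e.1 a| := abs_sub _ _
      _ ≤ 2 * ‖φ‖ := by linarith
  have hsq : ‖vacGrad L φ‖ ^ 2 ≤ (2 * Real.sqrt (3 * Fintype.card (Edge 3 L)) * ‖φ‖) ^ 2 := by
    rw [EuclideanSpace.norm_sq_eq, Fintype.sum_prod_type]
    calc ∑ e : Edge 3 L, ∑ a : Fin 3, ‖vacGrad L φ (e, a)‖ ^ 2 ≤ ∑ _e : Edge 3 L, ∑ _a : Fin 3, (2 * ‖φ‖) ^ 2 :=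
          Finset.sum_le_sum fun e _ => Finset.sum_le_sum fun a _ => by rw [Real.norm_eq_abs, sq_abs]; exact hc e a
      _ = (2 * Real.sqrt (3 * Fintype.card (Edge 3 L)) * ‖φ‖) ^ 2 := by
          simp only [Finset.sum_const, Finset.card_univ, Fintype.card_fin, nsmul_eq_mul]
          have h3 : Real.sqrt (3 * Fintype.card (Edge 3 L)) ^ 2 = 3 * Fintype.card (Edge 3 L) := Real.sq_sqrt (by positivity)
          have e4 : (2 * Real.sqrt (3 * Fintype.card (Edge 3 L)) * ‖φ‖) ^ 2 = 4 * Real.sqrt (3 * Fintype.card (Edge 3 L)) ^ 2 * ‖φ‖ ^ 2 := by ring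
          rw [e4, h3]; push_cast; ring
  exact (pow_le_pow_iff_left₀ (norm_nonneg _) (by positivity) two_ne_zero).1 hsq

/-- ★★★ **The kinetic defect of the central tube against a based chart copy is the flat form up to a cubic error**:
`kinDefect (orthoTube 1 x) (orthoTube 1 x') (basedExt (gno ∘ w)) ≤ ‖linkEmbed (x − x') + ∇(flatLin w)‖² + 201|E|τ³` for `√2‖x̂‖, √2‖x̂'‖, √3‖w‖ ≤ τ ≤ 1`
(`x, x'` on the cap). [cite: Luscher1983, §3] -/
theorem kinDefect_central_based_le {x x' : Edge 3 L → Fin 3 → ℝ} (hx : ∀ e, ∑ a, x e a ^ 2 ≤ 1) (hx' : ∀ e, ∑ a, x' e a ^ 2 ≤ 1)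
    (w : NzSite L → Fin 3 → ℝ) {τ : ℝ} (hτ1 : τ ≤ 1) (hτx : Real.sqrt 2 * ‖linkEmbed L x‖ ≤ τ) (hτx' : Real.sqrt 2 * ‖linkEmbed L x'‖ ≤ τ)
    (hτw : Real.sqrt 3 * ‖w‖ ≤ τ) :
    kinDefect L (orthoTube L 1 x) (orthoTube L 1 x') (basedExt L (fun y => gnoPoint (w y))) ≤
      ‖linkEmbed L (x - x') + vacGrad L (flatLin L w : Site 3 L → Fin 3 → ℝ)‖ ^ 2 + 201 * Fintype.card (Edge 3 L) * τ ^ 3 := by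
  have hτ0 : 0 ≤ τ := le_trans (by positivity) hτw
  set n : ℝ := (Fintype.card (Edge 3 L) : ℝ) with hn
  have hn1 : 1 ≤ n := by
    have : 0 < Fintype.card (Edge 3 L) := Fintype.card_pos
    rw [hn]; exact_mod_cast this
  -- §3 with the explicit vector parts
  have h1 := kinDefect_le_norm_sq_add (L := L) (orthoTube L 1 x) (orthoTube L 1 x') (basedExt L (fun y => gnoPoint (w y))) hτ1
    (fun e => (norm_su2Quat_orthoTube_one_sub_one_le hx e).trans hτx) (fun e => (norm_su2Quat_orthoTube_one_sub_one_le hx' e).trans hτx')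
    (fun z => (norm_su2Quat_basedExt_gno_sub_one_le w z).trans hτw)
  have hvec : (linkEmbed L (fun e a => vecPart (orthoTube L 1 x e) a - vecPart (orthoTube L 1 x' e) a) +
      vacGrad L (fun z => vecPart (basedExt L (fun y => gnoPoint (w y)) z))) =
      linkEmbed L (x - x') + vacGrad L (gnoParam L w : Site 3 L → Fin 3 → ℝ) := by
    have e1 : (fun e a => vecPart (orthoTube L 1 x e) a - vecPart (orthoTube L 1 x' e) a) = x - x' := by
      funext e a; rw [vecPart_orthoTube_one hx, vecPart_orthoTube_one hx']; rfl
    have e2 : (fun z => vecPart (basedExt L (fun y => gnoPoint (w y)) z)) = (gnoParam L w : Site 3 L → Fin 3 → ℝ) := by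
      funext z; exact vecPart_basedExt_gno w z
    rw [e1, e2]
  rw [hvec] at h1
  -- gnomonic vs orthographic is cubic
  set A := linkEmbed L (x - x') + vacGrad L (flatLin L w : Site 3 L → Fin 3 → ℝ) with hA
  set B := vacGrad L ((gnoParam L w : Site 3 L → Fin 3 → ℝ) - (flatLin L w : Site 3 L → Fin 3 → ℝ)) with hB
  have hsplit : linkEmbed L (x - x') + vacGrad L (gnoParam L w : Site 3 L → Fin 3 → ℝ) = A + B := by
    have hB' : vacGrad L (gnoParam L w : Site 3 L → Fin 3 → ℝ) = vacGrad L (flatLin L w : Site 3 L → Fin 3 → ℝ) + B := by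
      rw [hB, map_sub]; abel
    rw [hB', hA, add_assoc]
  have hw1 : ‖w‖ ≤ τ := by nlinarith [Real.sqrt_nonneg 3, Real.sq_sqrt (show (0 : ℝ) ≤ 3 by norm_num), norm_nonneg w]
  have hB3 : ‖B‖ ≤ 4 * Real.sqrt (3 * n) * τ ^ 3 := by
    have hdiff : ‖((gnoParam L w : Site 3 L → Fin 3 → ℝ) - (flatLin L w : Site 3 L → Fin 3 → ℝ))‖ ≤ 2 * ‖w‖ ^ 3 := by
      have h := norm_gnoParam_sub_flatLin_le L w
      rw [← Submodule.coe_sub, Submodule.norm_coe]; exact h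
    calc ‖B‖ ≤ 2 * Real.sqrt (3 * n) * ‖((gnoParam L w : Site 3 L → Fin 3 → ℝ) - (flatLin L w : Site 3 L → Fin 3 → ℝ))‖ := norm_vacGrad_le _
      _ ≤ 2 * Real.sqrt (3 * n) * (2 * ‖w‖ ^ 3) := by gcongr
      _ ≤ 2 * Real.sqrt (3 * n) * (2 * τ ^ 3) := by gcongr
      _ = 4 * Real.sqrt (3 * n) * τ ^ 3 := by ring
  have hA1 : ‖A‖ ≤ 5 * Real.sqrt (3 * n) * τ := by
    have hxx : ‖linkEmbed L (x - x')‖ ≤ Real.sqrt 2 * τ := by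
      rw [map_sub]
      have h2 : Real.sqrt 2 * Real.sqrt 2 = 2 := Real.mul_self_sqrt (by norm_num)
      calc ‖linkEmbed L x - linkEmbed L x'‖ ≤ ‖linkEmbed L x‖ + ‖linkEmbed L x'‖ := norm_sub_le _ _
        _ ≤ Real.sqrt 2 * τ := by nlinarith [Real.sqrt_nonneg 2, norm_nonneg (linkEmbed L x), norm_nonneg (linkEmbed L x')]
    have hflat : ‖vacGrad L (flatLin L w : Site 3 L → Fin 3 → ℝ)‖ ≤ 2 * Real.sqrt (3 * n) * τ := by
      calc ‖vacGrad L (flatLin L w : Site 3 L → Fin 3 → ℝ)‖ ≤ 2 * Real.sqrt (3 * n) * ‖(flatLin L w : Site 3 L → Fin 3 → ℝ)‖ := norm_vacGrad_le _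
        _ = 2 * Real.sqrt (3 * n) * ‖w‖ := by rw [← Submodule.coe_norm, norm_flatLin]
        _ ≤ 2 * Real.sqrt (3 * n) * τ := by gcongr
    have hs2 : Real.sqrt 2 ≤ 3 * Real.sqrt (3 * n) := by
      have h3n : Real.sqrt 2 ≤ Real.sqrt (3 * n) := Real.sqrt_le_sqrt (by linarith)
      nlinarith [Real.sqrt_nonneg (3 * n)]
    calc ‖A‖ ≤ ‖linkEmbed L (x - x')‖ + ‖vacGrad L (flatLin L w : Site 3 L → Fin 3 → ℝ)‖ := norm_add_le _ _
      _ ≤ Real.sqrt 2 * τ + 2 * Real.sqrt (3 * n) * τ := add_le_add hxx hflat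
      _ ≤ 5 * Real.sqrt (3 * n) * τ := by nlinarith
  have h3n : Real.sqrt (3 * n) ^ 2 = 3 * n := Real.sq_sqrt (by positivity)
  have hAB : ‖A + B‖ ^ 2 ≤ ‖A‖ ^ 2 + 168 * n * τ ^ 3 := by
    have h0 : ‖A + B‖ ≤ ‖A‖ + ‖B‖ := norm_add_le _ _
    have hτ4 : τ ^ 4 ≤ τ ^ 3 := by nlinarith [pow_nonneg hτ0 3]
    have hτ6 : τ ^ 6 ≤ τ ^ 3 := by nlinarith [pow_nonneg hτ0 3, pow_le_one₀ hτ0 hτ1 (n := 3)]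
    have hmid : 2 * ‖A‖ * ‖B‖ ≤ 2 * (5 * Real.sqrt (3 * n) * τ) * (4 * Real.sqrt (3 * n) * τ ^ 3) := by
      have := mul_le_mul hA1 hB3 (norm_nonneg _) (by positivity)
      nlinarith
    have hsqB : ‖B‖ ^ 2 ≤ (4 * Real.sqrt (3 * n) * τ ^ 3) ^ 2 := pow_le_pow_left₀ (norm_nonneg _) hB3 2
    have e1 : (2 : ℝ) * (5 * Real.sqrt (3 * n) * τ) * (4 * Real.sqrt (3 * n) * τ ^ 3) = 40 * Real.sqrt (3 * n) ^ 2 * τ ^ 4 := by ring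
    have e2 : (4 * Real.sqrt (3 * n) * τ ^ 3) ^ 2 = 16 * Real.sqrt (3 * n) ^ 2 * τ ^ 6 := by ring
    rw [e1, h3n] at hmid; rw [e2, h3n] at hsqB
    calc ‖A + B‖ ^ 2 ≤ (‖A‖ + ‖B‖) ^ 2 := pow_le_pow_left₀ (norm_nonneg _) h0 2
      _ = ‖A‖ ^ 2 + 2 * ‖A‖ * ‖B‖ + ‖B‖ ^ 2 := by ring
      _ ≤ ‖A‖ ^ 2 + 40 * (3 * n) * τ ^ 4 + 16 * (3 * n) * τ ^ 6 := by linarith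
      _ ≤ ‖A‖ ^ 2 + 168 * n * τ ^ 3 := by
          nlinarith [mul_le_mul_of_nonneg_left hτ4 (by positivity : (0:ℝ) ≤ 120 * n), mul_le_mul_of_nonneg_left hτ6 (by positivity : (0:ℝ) ≤ 48 * n)]
  rw [hsplit] at h1
  calc kinDefect L (orthoTube L 1 x) (orthoTube L 1 x') (basedExt L (fun y => gnoPoint (w y))) ≤ ‖A + B‖ ^ 2 + 33 * n * τ ^ 3 := h1
    _ ≤ ‖A‖ ^ 2 + 168 * n * τ ^ 3 + 33 * n * τ ^ 3 := by linarith
    _ = ‖A‖ ^ 2 + 201 * n * τ ^ 3 := by ring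

end Summit.QuantumFields.YangMills.Theorems.FemtoTransferGap.TwoLattice.ConstTube

end
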